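import Summits.AnomalousDissipation.AnomalousDissipation.Theorems.PumpedMirrorMirrorFloorTGDuality
import Summits.AnomalousDissipation.AnomalousDissipation.Theorems.PumpedMirrorMirrorFloorTGExplicitEnergy

/-!
# `PumpedMirror.MirrorFloorTG` (stmt-AnomalousDissipation-15372) REDUCED: the crux is equivalent to the loudness of relaxed
# mirror statistics at energy levels `E ≥ 1/(8π)` only

Line `registered`, lead `prover-line-stmt-AnomalousDissipation-15372-c2-0` (continuation c2, 2026-08-17); supports the crux.
Glue of the landed equivalence `mirrorFloorTG_iff_mirrorLawsLoudTG` (p146584: crux ⟺ S3, all levels `E > 0`) with the explicit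
settlement `mirrorLawsLoudTG_below_inv_eight_pi` (S3 holds vacuously below `1/(8π)`): the registered open stub S3 only has content
for `E ≥ 1/(8π)`, and the crux is EQUIVALENT to that large-energy statement (`mirrorFloorTG_iff_mirrorLawsLoudTG_largeEnergy`).
This is the typed form of the settled/open split of the `E`-axis after cycle 2 of the line; refuters read it as: every witness
against the crux is a family `ν_j → 0` of relaxed K-statistics at ONE level `E ≥ 1/(8π)` with `ε(μ_j) → 0`.
-/

noncomputable section

-- `Summit.<Summit>.<Problem>` is the tree's mandated summit-side namespace (CONVENTIONS §2); for this single-conjunct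
-- summit the two coincide, so the duplicate namespace component is deliberate.
set_option linter.dupNamespace false

namespace Summit.AnomalousDissipation.AnomalousDissipation.Theorems.PumpedMirrorMirrorFloorTG

open MeasureTheory Filter Topology UnitAddTorus
open scoped InnerProductSpace RealInnerProductSpace ENNReal NNReal
open Literature.Analysis.FunctionSpaces Literature.Analysis.FunctionSpaces.Torus Literature.Analysis.FluidPDE
open Summit.AnomalousDissipation.AnomalousDissipation.Theses.PumpedMirror

/-- **S3 from its large-energy part.** If every relaxed K-statistic of `NS_ν(f_TG)` below an energy level `E ≥ 1/(8π)` is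
`ε₀(E)`-loud for `ν < ν₀(E)`, then the same holds at EVERY level `E > 0` (below `1/(8π)` the class is empty,
`mirrorLawsLoudTG_below_inv_eight_pi`). -/
theorem mirrorLawsLoudTG_of_largeEnergy
    (hlarge : ∀ f : UnitAddTorus (Fin 3) → EuclideanSpace ℝ (Fin 3),
      f = (fun x => !₂[(fourier 1 (x 0) : ℂ).im * (fourier 1 (x 1) : ℂ).re * (fourier 1 (x 2) : ℂ).re,
        -((fourier 1 (x 0) : ℂ).re * (fourier 1 (x 1) : ℂ).im * (fourier 1 (x 2) : ℂ).re), (0 : ℝ)]) →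
    ∀ E : ℝ, 1 / (8 * Real.pi) ≤ E → ∃ ε₀ ν₀ : ℝ, 0 < ε₀ ∧ 0 < ν₀ ∧ ∀ ν : ℝ, 0 < ν → ν < ν₀ →
      ∀ μ : Measure (Torus.energySpace (Fin 3)), IsProbabilityMeasure μ →
        (∀ᵐ u ∂μ, ∀ i j : Fin 3,
          (fun x => (u.1 : UnitAddTorus (Fin 3) → EuclideanSpace ℝ (Fin 3)) (Function.update x i (-x i)) j)
            =ᵐ[volume]
          (fun x => if j = i then -((u.1 : UnitAddTorus (Fin 3) → EuclideanSpace ℝ (Fin 3)) x j)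
            else (u.1 : UnitAddTorus (Fin 3) → EuclideanSpace ℝ (Fin 3)) x j)) →
        (∀ᵐ u ∂μ, ‖u‖ ^ 2 ≤ E) →
        Torus.ensembleEnstrophy μ < ⊤ →
        (∀ Φ : Torus.CylindricalTest (Fin 3),
          Integrable (fun u => Torus.nsGeneratorPairing ν f u (Φ.grad u)) μ ∧
            ∫ u, Torus.nsGeneratorPairing ν f u (Φ.grad u) ∂μ = 0) →
        Integrable (fun u : Torus.energySpace (Fin 3) => Torus.pairing u.1 f) μ →
        Torus.ensembleDissipation ν μ ≤ ∫ u, Torus.pairing u.1 f ∂μ →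
        ε₀ ≤ Torus.ensembleDissipation ν μ) :
    ∀ f : UnitAddTorus (Fin 3) → EuclideanSpace ℝ (Fin 3),
      f = (fun x => !₂[(fourier 1 (x 0) : ℂ).im * (fourier 1 (x 1) : ℂ).re * (fourier 1 (x 2) : ℂ).re,
        -((fourier 1 (x 0) : ℂ).re * (fourier 1 (x 1) : ℂ).im * (fourier 1 (x 2) : ℂ).re), (0 : ℝ)]) →
    ∀ E : ℝ, 0 < E → ∃ ε₀ ν₀ : ℝ, 0 < ε₀ ∧ 0 < ν₀ ∧ ∀ ν : ℝ, 0 < ν → ν < ν₀ →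
      ∀ μ : Measure (Torus.energySpace (Fin 3)), IsProbabilityMeasure μ →
        (∀ᵐ u ∂μ, ∀ i j : Fin 3,
          (fun x => (u.1 : UnitAddTorus (Fin 3) → EuclideanSpace ℝ (Fin 3)) (Function.update x i (-x i)) j)
            =ᵐ[volume]
          (fun x => if j = i then -((u.1 : UnitAddTorus (Fin 3) → EuclideanSpace ℝ (Fin 3)) x j)
            else (u.1 : UnitAddTorus (Fin 3) → EuclideanSpace ℝ (Fin 3)) x j)) →
        (∀ᵐ u ∂μ, ‖u‖ ^ 2 ≤ E) →
        Torus.ensembleEnstrophy μ < ⊤ →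
        (∀ Φ : Torus.CylindricalTest (Fin 3),
          Integrable (fun u => Torus.nsGeneratorPairing ν f u (Φ.grad u)) μ ∧
            ∫ u, Torus.nsGeneratorPairing ν f u (Φ.grad u) ∂μ = 0) →
        Integrable (fun u : Torus.energySpace (Fin 3) => Torus.pairing u.1 f) μ →
        Torus.ensembleDissipation ν μ ≤ ∫ u, Torus.pairing u.1 f ∂μ →
        ε₀ ≤ Torus.ensembleDissipation ν μ := by
  intro f hf E hE
  by_cases hlt : E < 1 / (8 * Real.pi)
  · exact mirrorLawsLoudTG_below_inv_eight_pi f hf E hE hlt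
  · exact hlarge f hf E (not_lt.1 hlt)

/-- **THE CRUX ⟺ ITS LARGE-ENERGY DUAL FORM.** `MirrorFloorTG` holds iff for every energy level `E ≥ 1/(8π)` there are
`ε₀, ν₀ > 0` such that for `ν ∈ (0, ν₀)` every relaxed stationary K-statistic of `NS_ν(f_TG)` carried by `Fix K ∩ {|u|² ≤ E}`
(finite mean enstrophy, cylindrical Liouville identities, integrable work, `ν∫‖∇u‖²dμ ≤ ∫(u,f_TG)dμ`) dissipates `≥ ε₀`. The
levels `E < 1/(8π)` carry no such statistic at all (`relaxed_empty_below_inv_eight_pi`); this is the whole remaining content of the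
crux after cycle 2 of line `registered`. [cite: RosaTemam2020, Thm 6.2–6.4] -/
theorem mirrorFloorTG_iff_mirrorLawsLoudTG_largeEnergy :
    Summit.AnomalousDissipation.AnomalousDissipation.Theses.PumpedMirror.MirrorFloorTG ↔ ∀ f : UnitAddTorus (Fin 3) → EuclideanSpace ℝ (Fin 3),
      f = (fun x => !₂[(fourier 1 (x 0) : ℂ).im * (fourier 1 (x 1) : ℂ).re * (fourier 1 (x 2) : ℂ).re,
        -((fourier 1 (x 0) : ℂ).re * (fourier 1 (x 1) : ℂ).im * (fourier 1 (x 2) : ℂ).re), (0 : ℝ)]) →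
    ∀ E : ℝ, 1 / (8 * Real.pi) ≤ E → ∃ ε₀ ν₀ : ℝ, 0 < ε₀ ∧ 0 < ν₀ ∧ ∀ ν : ℝ, 0 < ν → ν < ν₀ →
      ∀ μ : Measure (Torus.energySpace (Fin 3)), IsProbabilityMeasure μ →
        (∀ᵐ u ∂μ, ∀ i j : Fin 3,
          (fun x => (u.1 : UnitAddTorus (Fin 3) → EuclideanSpace ℝ (Fin 3)) (Function.update x i (-x i)) j)
            =ᵐ[volume]
          (fun x => if j = i then -((u.1 : UnitAddTorus (Fin 3) → EuclideanSpace ℝ (Fin 3)) x j)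
            else (u.1 : UnitAddTorus (Fin 3) → EuclideanSpace ℝ (Fin 3)) x j)) →
        (∀ᵐ u ∂μ, ‖u‖ ^ 2 ≤ E) →
        Torus.ensembleEnstrophy μ < ⊤ →
        (∀ Φ : Torus.CylindricalTest (Fin 3),
          Integrable (fun u => Torus.nsGeneratorPairing ν f u (Φ.grad u)) μ ∧
            ∫ u, Torus.nsGeneratorPairing ν f u (Φ.grad u) ∂μ = 0) →
        Integrable (fun u : Torus.energySpace (Fin 3) => Torus.pairing u.1 f) μ →
        Torus.ensembleDissipation ν μ ≤ ∫ u, Torus.pairing u.1 f ∂μ →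
        ε₀ ≤ Torus.ensembleDissipation ν μ := by
  constructor
  · intro h f hf E hE
    have hE0 : 0 < E := lt_of_lt_of_le (by positivity) hE
    exact (mirrorLawsLoudTG_of_mirrorFloorTG h) f hf E hE0
  · intro h
    exact mirrorFloorTG_of_mirrorLawsLoudTG (mirrorLawsLoudTG_of_largeEnergy h)

end Summit.AnomalousDissipation.AnomalousDissipation.Theorems.PumpedMirrorMirrorFloorTG

end
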